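import Literature.Probability.LatticeModels.VillainSpinWaveReduction
import HarnessLib

/-!
# `FrohlichSpencerVillainSpinWaveBound` (Fröhlich–Spencer 1982 / Dario–Wu 2020 Prop. 1.1): fact
# decomposition into the two remaining printed clauses

Topic `Literature/Probability/LatticeModels`. FACT-SPLIT file (librarian, mode `fact-decompose`,
2026-08-16) for the budget-capped XL named fact
`Literature.Probability.LatticeModels.FrohlichSpencerVillainSpinWaveBound` (`VillainSpinWave.lean`),
the transcription of Dario–Wu 2020, Proposition 1.1 (after Fröhlich–Spencer, Comm. Math. Phys. 83
(1982)) for the zero-boundary-condition Villain rotator in `ℤ^d`, `d ≥ 3`, with four clauses: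
(i) the thermodynamic limit `G` of `⟨S_0·S_x⟩_{□_n,β,0}` exists; (ii) clustering
`|G − c₀| ≤ C/‖x‖^{d−2}`; (iii) the spin-wave upper bound `G ≤ exp(−g(x)/(2β))`; (iv) the spin-wave
lower bound `exp((−1/(2β) + r(β)) g(x)) ≤ G` with `β r(β) → 0`; `g(x) = latticeGreen 0 − latticeGreen x`.

State of the tree (2026-08-16): (i) is PROVED for all `d ≥ 1`, `β > 0`
(`tendsto_dirichletVillainTwoPoint_ciInf`, Ginibre pinning, `VillainDirichletLimit.lean`; the limit is
`G_β(x) = ⨅_n ⟨S_0·S_x⟩_{□_n,β,0}`), (iii) is PROVED for all `β > 0`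
(`le_exp_of_tendsto_dirichletVillainTwoPoint`, exact duality, `VillainSpinWaveProofs.lean`), and
`FrohlichSpencerVillainSpinWaveBound_of_lowerBound_of_clustering` (`VillainSpinWaveReduction.lean`)
PROVES the fact from the two remaining printed clauses (iv) and (ii), stated for that limit. Under
D-0026 those clauses stayed hypotheses; this file names them (D-0014 named facts) — they are
Fröhlich–Spencer's renormalisation-group estimates on the dual vortex (Coulomb) gas, FS82 §§3–5, the
genuinely hard and mutually independent halves of the printed result — and records the PROVED
assembly:

* `FrohlichSpencer1982_spinWaveLowerBound` — clause (iv): for `d ≥ 3` there are `β₀ > 0` and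
  `r : ℝ → ℝ` with `β r(β) → 0` such that `exp((−1/(2β) + r(β)) g(x)) ≤ G_β(x)` for all `β > β₀` and
  all `x` (the dilute vortex gas renormalises the spin-wave stiffness by `o(1/β)` only);
* `FrohlichSpencer1982_clustering` — clause (ii): for `d ≥ 3` and `β` large there are `c₀(β), C(β)`
  with `|G_β(x) − c₀| ≤ C/‖x‖^{d−2}` for `x ≠ 0` (long-range order with power-law approach);
* `FrohlichSpencerVillainSpinWaveBound_holds_of : … → … → FrohlichSpencerVillainSpinWaveBound` —
  PROVED (it is `FrohlichSpencerVillainSpinWaveBound_of_lowerBound_of_clustering`).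

Both children are verbatim the hypotheses `hlow`, `hclust` of that reduction; neither restates the
parent (each is one of its four clauses, the other two being theorems of the tree). The finite-volume
vortex-gas form of (iv) is `FrohlichSpencerVillainSpinWaveBound_of_vortexBound_of_clustering`.

## References

* [DarioWu2020] P. Dario, W. Wu, *Massless phases for the Villain model in `d ≥ 3`*,
  arXiv:2002.02946, Ch. 1 §1, Proposition 1.1 (PDF pp. 4–5).
* [FrohlichSpencerCMP1982] J. Fröhlich, T. Spencer, *Massless phases and symmetry restoration in
  abelian gauge theories and spin systems*, Comm. Math. Phys. 83 (1982) 411–454, §§3–5.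
-/

noncomputable section

open MeasureTheory Measure Finset Function Set Filter
open scoped Topology
open Literature.MathematicalPhysics.QuantumFieldTheory

namespace Literature.Probability.LatticeModels

open DirichletVillain

/-- NAMED FACT — **Fröhlich–Spencer 1982 (as printed in Dario–Wu 2020, Prop. 1.1), clause (iv): the
spin-wave LOWER bound with `o(1/β)` correction.** For every `d ≥ 3` there are `β₀ > 0` and a
correction `r : ℝ → ℝ` with `β · r(β) → 0` (`β → ∞`) such that for every `β > β₀` and every site `x`,
`exp((−1/(2β) + r(β)) · (latticeGreen 0 − latticeGreen x)) ≤ G_β(x)`, where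
`G_β(x) = ⨅_n ⟨S_0·S_x⟩_{□_n,β,0}` (`= lim_n dirichletVillainTwoPoint β n x`, the thermodynamic limit,
proved to exist in `VillainDirichletLimit.lean`) and `latticeGreen 0 − latticeGreen x =
(δ_0 − δ_x, (−Δ)⁻¹(δ_0 − δ_x))`. Printed: "as `β → ∞`, … `⟨S_0 · S_x⟩_{μ^V_β} ≥
exp((δ_0 − δ_x, (−1/(2β) + o(1/β)) Δ⁻¹(δ_0 − δ_x)))`" — Fröhlich–Spencer's one-step
renormalisation of the dual lattice Coulomb gas (FS82 §§3–5). Hypothesis `hlow` of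
`FrohlichSpencerVillainSpinWaveBound_of_lowerBound_of_clustering`, verbatim. Users take
`(h : FrohlichSpencer1982_spinWaveLowerBound)`.
[cite: DarioWu2020, Proposition 1.1 (PDF pp. 4–5), lower bound] [cite: FrohlichSpencerCMP1982, §§3–5] -/
def FrohlichSpencer1982_spinWaveLowerBound : Prop :=
  ∀ d : ℕ, 3 ≤ d → ∃ β₀ : ℝ, 0 < β₀ ∧ ∃ r : ℝ → ℝ,
    Tendsto (fun β : ℝ => β * r β) atTop (𝓝 0) ∧
      ∀ β : ℝ, β₀ < β → ∀ x : Site d,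
        Real.exp ((-(1 / (2 * β)) + r β) * (latticeGreen (0 : Site d) - latticeGreen x)) ≤
          ⨅ n : ℕ, dirichletVillainTwoPoint β n x

/-- NAMED FACT — **Fröhlich–Spencer 1982 (as printed in Dario–Wu 2020, Prop. 1.1), clause (ii):
clustering / long-range order with power-law approach.** For every `d ≥ 3` there is `β₁` such that
for every `β > β₁` there are constants `c₀ = c₀(β, d)`, `C = C(β, d)` with
`|G_β(x) − c₀| ≤ C / ‖x‖^{d−2}` for every site `x ≠ 0` (`‖·‖` the sup norm on `Site d = Fin d → ℤ`;
`G_β(x) = ⨅_n ⟨S_0·S_x⟩_{□_n,β,0}`, the proved thermodynamic limit). Printed: "There exist constants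
`β₀ = β₀(d)`, `c₀ = c₀(β,d)`, such that for all `β > β₀`, `⟨S_0 · S_x⟩_{μ^V_β} = c₀ + O(1/|x|^{d−2})`."
Hypothesis `hclust` of `FrohlichSpencerVillainSpinWaveBound_of_lowerBound_of_clustering`, verbatim.
Users take `(h : FrohlichSpencer1982_clustering)`.
[cite: DarioWu2020, Proposition 1.1 (PDF pp. 4–5), first display] [cite: FrohlichSpencerCMP1982, §§3–5] -/
def FrohlichSpencer1982_clustering : Prop :=
  ∀ d : ℕ, 3 ≤ d → ∃ β₁ : ℝ, ∀ β : ℝ, β₁ < β → ∃ c₀ C : ℝ, ∀ x : Site d, x ≠ 0 →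
    |(⨅ n : ℕ, dirichletVillainTwoPoint β n x) - c₀| ≤ C / ‖x‖ ^ (d - 2)

/-- **Assembly (PROVED): the named fact from clauses (iv) and (ii)** — with (i) the thermodynamic
limit (`tendsto_dirichletVillainTwoPoint_ciInf`) and (iii) the spin-wave upper bound
(`le_exp_of_tendsto_dirichletVillainTwoPoint`) theorems of the tree; this is
`FrohlichSpencerVillainSpinWaveBound_of_lowerBound_of_clustering`. Discharging both children
discharges `FrohlichSpencerVillainSpinWaveBound`. [cite: DarioWu2020, Proposition 1.1 (PDF pp. 4–5)] -/
theorem FrohlichSpencerVillainSpinWaveBound_holds_of (hlow : FrohlichSpencer1982_spinWaveLowerBound)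
    (hclust : FrohlichSpencer1982_clustering) : FrohlichSpencerVillainSpinWaveBound :=
  FrohlichSpencerVillainSpinWaveBound_of_lowerBound_of_clustering hlow hclust

end Literature.Probability.LatticeModels

end
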